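import Literature.NumberTheory.DiophantineGeometry.GenEllLemma37Holds
import Literature.NumberTheory.DiophantineGeometry.GenEllLAdicImageContainsSL2
import Literature.NumberTheory.DiophantineGeometry.GenEllGaloisImageBaseChange
import Literature.NumberTheory.DiophantineGeometry.GenEllTorsion15Field
import Literature.NumberTheory.DiophantineGeometry.GenEllBaseChangeInvariants
import Literature.NumberTheory.DiophantineGeometry.GenEllBaseChangeRamification
import Literature.NumberTheory.DiophantineGeometry.GenEllMellReduction
import Literature.NumberTheory.EllipticCurves.MultiplicativeReductionJValuationProofs
import HarnessLib

/-!
# [GenEll] Theorem 3.8 (Full Special Linear Galois Actions) — PROOF modulo the local transvection at `l`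

S. Mochizuki, *Arithmetic elliptic curves in general position*, Math. J. Okayama Univ. **52** (2010)
[cite: MochizukiGenEll2010], Theorem 3.8 and its proof, pp. 19–20 (quoted in `GenEllFullGalois.lean`).

The named fact `GenEll_thm38` (`GenEllFullGalois.lean`, abc-iut-S4) is PROVED from the printed
ingredients, all of which are now tree theorems —
* `L′ = L(E[15])`, `[L′:L] ∣ 23040`, `E_{L′}` semistable (`exists_torsion15Field`,
  `isSemistable_mk_map_of_fixingSubgroup_le`; Raynaud's criterion, seat abc-iut-S5);
* the transports of `d`, `ht_Falt`, `deg_∞`, `[E] ∈ K_V`, `[E] ∈ Exc`, local heights and their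
  divisibility along `L ⊂ L′` (`GenEllBaseChangeInvariants` / `…Ramification`, seat abc-iut-S-d3);
* Lemma 3.7 (`GenEll_lemma37_holds`, seats abc-iut-S-d4 / S-d1) applied to `E_{L′}`;
* "(P6)": no `l`-cyclic subgroup scheme + a transvection of order `l` ⇒ `SL₂(𝔽_l) ⊆ Im`, and Lemma 3.1
  (iv) level by level ⇒ `SL₂(ℤ/lⁿ) ⊆ Im` (`GenEllImageModLContainsSL2`, `GenEllLAdicImageContainsSL2`);
* descent of the conclusion from `Gal(Q̄/L′)` to `Gal(Q̄/L)` (`GenEllGaloisImageBaseChange`) —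
EXCEPT for one local input, taken as the explicit hypothesis `hγ`: the existence of a Galois element of
order `l` on `E[l]` at a prime `w` of MULTIPLICATIVE reduction with `l ∤ h_w` WHEN `w ∣ l` ("the
discussion of the local theory preceding Lemma 3.2", [FC] III Cor. 7.3 / Silverman *ATAEC* V.6.1 at
residue characteristic `l`; the case `w ∤ l` is the tree theorem
`exists_orderOf_galoisRepTorsion_eq_of_hasMultiplicativeReductionAt_of_not_dvd`, seat abc-iut-S5).
Proof-only; no definitions; DAG node `GenEll:Thm3.8`, seat abc-iut-S-d4.
-/

noncomputable section

open scoped Classical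
open NumberField IsDedekindDomain

namespace Literature.NumberTheory.DiophantineGeometry.GenEll

/-- Real bookkeeping of "if `E_L` and `l` satisfy condition (a) of Theorem 3.8, then `E_{L′}` and `l`
satisfy condition (a) of Lemma 3.7 [perhaps for a different `C`]" (p. 20): with `d′ = k·d`, `1 ≤ k ≤ 23040`
and `C ≥ C₇·23040^ε`, `23040·100·d·(h + C·d^ε) ≤ l` implies `100·d′·(h + C₇·d′^ε) ≤ l`.
[cite: MochizukiGenEll2010, Thm 3.8 p.20] -/
private theorem condA_transfer {ε C₇ C h d k l : ℝ} (hε : 0 < ε) (hC₇ : 0 < C₇)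
    (hC : C₇ * (23040 : ℝ) ^ ε ≤ C) (hk1 : 1 ≤ k) (hk : k ≤ 23040) (hd : 1 ≤ d) (hl0 : 0 ≤ l)
    (hl : 23040 * 100 * d * (h + C * d ^ ε) ≤ l) :
    100 * (k * d) * (h + C₇ * (k * d) ^ ε) ≤ l := by
  have hd0 : 0 ≤ d := by linarith
  have hk0 : 0 ≤ k := by linarith
  have hkd : (k * d) ^ ε = k ^ ε * d ^ ε := Real.mul_rpow hk0 hd0
  have hkε : k ^ ε ≤ (23040 : ℝ) ^ ε := Real.rpow_le_rpow hk0 hk hε.le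
  have hdε : 0 ≤ d ^ ε := Real.rpow_nonneg hd0 ε
  have hkε0 : 0 ≤ k ^ ε := Real.rpow_nonneg hk0 ε
  by_cases hneg : h + C₇ * (k * d) ^ ε ≤ 0
  · have : 100 * (k * d) * (h + C₇ * (k * d) ^ ε) ≤ 0 :=
      mul_nonpos_of_nonneg_of_nonpos (by positivity) hneg
    linarith
  push Not at hneg
  -- `h + C₇ (kd)^ε ≤ h + C d^ε`
  have h1 : C₇ * (k * d) ^ ε ≤ C * d ^ ε := by
    rw [hkd]
    calc C₇ * (k ^ ε * d ^ ε) = (C₇ * k ^ ε) * d ^ ε := by ring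
      _ ≤ (C₇ * (23040 : ℝ) ^ ε) * d ^ ε :=
          mul_le_mul_of_nonneg_right (mul_le_mul_of_nonneg_left hkε hC₇.le) hdε
      _ ≤ C * d ^ ε := mul_le_mul_of_nonneg_right hC hdε
  have h2 : 0 < h + C * d ^ ε := by linarith
  calc 100 * (k * d) * (h + C₇ * (k * d) ^ ε)
      ≤ 100 * (23040 * d) * (h + C₇ * (k * d) ^ ε) := by
        apply mul_le_mul_of_nonneg_right _ hneg.le
        nlinarith
    _ ≤ 100 * (23040 * d) * (h + C * d ^ ε) := by
        apply mul_le_mul_of_nonneg_left (by linarith) (by positivity)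
    _ = 23040 * 100 * d * (h + C * d ^ ε) := by ring
    _ ≤ l := hl

/-- A prime coprime to `30` does not divide `23040 = 2⁹·3²·5`, nor any of its divisors.
[cite: MochizukiGenEll2010, Thm 3.8 p.20] -/
private theorem not_dvd_of_coprime_thirty {l k : ℕ} (hl : l.Prime) (h30 : Nat.Coprime l 30)
    (hk : k ∣ 23040) : ¬ l ∣ k := by
  intro hlk
  have h2 : l ∣ 23040 := hlk.trans hk
  have : l ∣ 2 ^ 9 * 3 ^ 2 * 5 := by norm_num; exact h2
  rcases (Nat.Prime.dvd_mul hl).mp this with h' | h5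
  · rcases (Nat.Prime.dvd_mul hl).mp h' with h2' | h3
    · have := (Nat.prime_dvd_prime_iff_eq hl Nat.prime_two).mp (hl.dvd_of_dvd_pow h2')
      subst this; norm_num at h30
    · have := (Nat.prime_dvd_prime_iff_eq hl Nat.prime_three).mp (hl.dvd_of_dvd_pow h3)
      subst this; norm_num at h30
  · have := (Nat.prime_dvd_prime_iff_eq hl Nat.prime_five).mp h5
    subst this; norm_num at h30

/-- A prime coprime to `30` is `≥ 5` (indeed `≥ 7`). [cite: MochizukiGenEll2010, Thm 3.8 p.19] -/
private theorem five_le_of_coprime_thirty {l : ℕ} (hl : l.Prime) (h30 : Nat.Coprime l 30) : 5 ≤ l := by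
  refine hl.five_le_of_ne_two_of_ne_three ?_ ?_
  · rintro rfl; norm_num at h30
  · rintro rfl; norm_num at h30

/-- **[GenEll] Theorem 3.8 (Full Special Linear Galois Actions), modulo the local transvection at
residue characteristic `l`.**  Hypothesis `hγ`: for every presented elliptic curve `Q`, prime `l` and
prime `w ∣ l` of multiplicative reduction whose local height is prime to `l`, some element of
`Gal(Q̄/Q.F)` acts on `Q[l]` with order `l` (the Tate-curve transvection, Silverman *ATAEC* V.6.1 /
[FC] III Cor. 7.3, at `p = l`; at `p ≠ l` it is the tree's theorem).  Conclusion: the named fact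
`GenEll_thm38` — for `K_V` compactly bounded and `ε > 0` there are `C > 0` and a Galois-finite `Exc`
such that for `[E_L] ∉ Exc` and a prime `l` with (a) `l ≥ 23040·100·d·(ht_Falt + C·d^ε)` and a prime
of potentially multiplicative reduction, or (b) `[E_L] ∈ K_V`, `l` prime to the local heights at the
primes of potentially multiplicative reduction and to `30`, the image of `Gal(Q̄/L)` in `Aut(E[lⁿ])`
contains the automorphisms of determinant `1` for every `n ≥ 1`. [cite: MochizukiGenEll2010, Thm 3.8 p.19] -/
theorem GenEll_thm38_of_localTransvection
    (hγ : ∀ (Q : EllPoint) (l : ℕ) [Fact l.Prime] (w : HeightOneSpectrum (𝓞 Q.F)),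
      Q.W.HasMultiplicativeReductionAt w → (l : 𝓞 Q.F) ∈ w.asIdeal →
      ¬ ((l : ℤ) ∣ Q.localHeight w) →
      ∃ σ : Field.absoluteGaloisGroup Q.F, orderOf (Q.W.galoisRepTorsion (l : ℤ) σ) = l) :
    GenEll_thm38 := by
  intro D ε hε
  -- Lemma 3.7 for `(K_V, ε)` and the lower bound `ht_Falt ≥ -K/24` from Prop. 3.4
  obtain ⟨C₇, hC₇, Exc, hExc, h37⟩ := GenEll_lemma37_holds D ε hε
  obtain ⟨-, ⟨K', hK'⟩, -⟩ := prop34Ineq_of_pos (by norm_num : (0 : ℝ) < 1)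
  set K : ℝ := max K' 0 with hKdef
  have hK0 : 0 ≤ K := le_max_right _ _
  have hFalt_lb : ∀ Q : EllPoint, -(K / 24) ≤ Q.htFalt := fun Q => by
    have h1 := hK' Q (Set.mem_univ _)
    have h2 : 0 ≤ Q.htInf := Q.degInf_nonneg.trans Q.degInf_le_htInf
    have h3 : K' ≤ K := le_max_left _ _
    norm_num at h1
    linarith
  have h23040 : 0 < (23040 : ℝ) ^ ε := Real.rpow_pos_of_pos (by norm_num) ε
  set C : ℝ := C₇ * (23040 : ℝ) ^ ε + K / 24 + 1 with hCdef
  have hCpos : 0 < C := by have := mul_pos hC₇ h23040; rw [hCdef]; positivity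
  have hCC₇ : C₇ * (23040 : ℝ) ^ ε ≤ C := by rw [hCdef]; linarith [div_nonneg hK0 (by norm_num : (0:ℝ) ≤ 24)]
  refine ⟨C, hCpos, Exc, hExc, ?_⟩
  intro P l hlF hnot hcond n hn
  have hl : l.Prime := hlF.out
  -- the field `L′ = L(E[15])` and the base-changed presentation `P′`
  obtain ⟨L', hfin, hgal, h3, h5, hdeg⟩ := P.exists_torsion15Field
  haveI := hfin
  haveI := hgal
  haveI : NumberField L' := NumberField.of_module_finite P.F L'
  let P' : EllPoint := EllPoint.mk L' (P.W.map (algebraMap P.F L'))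
  have hss' : P'.IsSemistable := P.isSemistable_mk_map_of_fixingSubgroup_le L' h3 h5
  -- the transports (abc-iut-S-d3)
  have hdeg' : (P'.degree : ℝ) = (Module.finrank P.F L' : ℝ) * P.degree := by
    have h := P.degree_baseChange L'
    exact_mod_cast h
  have hFalt' : P'.htFalt = P.htFalt := P.htFalt_baseChange L'
  have hExc' : ¬ MellExcMem Exc P' := fun h => hnot ((P.mellExcMem_baseChange_iff L' Exc).mp h)
  have hk1 : (1 : ℝ) ≤ Module.finrank P.F L' := by exact_mod_cast Module.finrank_pos
  have hk : (Module.finrank P.F L' : ℝ) ≤ 23040 := by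
    exact_mod_cast Nat.le_of_dvd (by norm_num) hdeg
  have hd : (1 : ℝ) ≤ P.degree := by exact_mod_cast P.degree_pos
  have hl0 : (0 : ℝ) ≤ l := Nat.cast_nonneg _
  -- multiplicative primes of `E_{L′}`: from potentially multiplicative primes (semistability)
  have hmult_of_pot : ∀ w : HeightOneSpectrum (𝓞 L'), P'.IsPotMult w →
      P'.W.HasMultiplicativeReductionAt w := fun w hw => by
    refine (hss' w).resolve_left fun hgood => ?_
    have := P'.localHeight_nonpos_of_hasGoodReductionAt w hgood
    exact absurd hw (not_lt.mpr this)
  -- Lemma 3.7 for `E_{L′}`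
  obtain ⟨h37a, h37b, h37c⟩ := h37 P' l hl hss'
  -- the conditions of Lemma 3.7 for `E_{L′}` from those of Theorem 3.8 for `E_L`
  have hcond' : (100 * (P'.degree : ℝ) * (P'.htFalt + C₇ * (P'.degree : ℝ) ^ ε) ≤ l ∧ P'.HasMultPlace) ∨
      (D.Mem P' ∧ ∀ w : HeightOneSpectrum (𝓞 L'), P'.W.HasMultiplicativeReductionAt w →
        ¬ ((l : ℤ) ∣ P'.localHeight w)) := by
    rcases hcond with ⟨hlA, hpot⟩ | ⟨hmem, hcop, h30⟩
    · refine Or.inl ⟨?_, ?_⟩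
      · rw [hdeg', hFalt']
        exact condA_transfer hε hC₇ hCC₇ hk1 hk hd hl0 hlA
      · obtain ⟨w, hw⟩ := P.hasPotMultPlace_baseChange L' hpot
        exact ⟨w, hmult_of_pot w hw⟩
    · refine Or.inr ⟨P.mem_baseChange L' D hmem, fun w hw => ?_⟩
      have hpos := P'.localHeight_pos_of_hasMultiplicativeReductionAt w hw
      have hv : P.IsPotMult (Literature.IUT.LogVolume.finBelow P.F L' w) :=
        (P.isPotMult_baseChange_iff L' w).mp hpos
      refine P.not_dvd_localHeight_baseChange L' hl w (hcop _ hv) ?_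
      exact not_dvd_ramificationIdx'_finBelow P.F L' (not_dvd_of_coprime_thirty hl h30 hdeg) w
  -- no `l`-cyclic subgroup scheme over `L′` (Lemma 3.7, last clause, with `[E] ∉ Exc`)
  have hno' : ¬ P'.AdmitsLCyclic l := fun hcyc => hExc' (h37c (by
    rcases hcond' with hA | hB
    · exact Or.inl hA
    · exact Or.inr hB) hcyc)
  -- a multiplicative prime `w₀` of `E_{L′}` with `l ∤ h_{w₀}`
  obtain ⟨w₀, hw₀, hndvd⟩ : ∃ w : HeightOneSpectrum (𝓞 L'), P'.W.HasMultiplicativeReductionAt w ∧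
      ¬ ((l : ℤ) ∣ P'.localHeight w) := by
    rcases hcond' with ⟨hlA, ⟨w, hw⟩⟩ | ⟨hmem, hcop⟩
    · exact ⟨w, hw, P'.not_dvd_localHeight_of_lt w hw (h37a ⟨hlA, ⟨w, hw⟩⟩ w hw)⟩
    · obtain ⟨w, hw⟩ := h37b ⟨hmem, hcop⟩ hExc'
      exact ⟨w, hw, hcop w hw⟩
  -- an element of order `l` on `E_{L′}[l]` (the tree at `w ∤ l`, the hypothesis `hγ` at `w ∣ l`)
  have hord : ∃ σ : Field.absoluteGaloisGroup L', orderOf (P'.W.galoisRepTorsion (l : ℤ) σ) = l := by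
    by_cases hwl : ((l : ℕ) : 𝓞 L') ∈ w₀.asIdeal
    · exact hγ P' l w₀ hw₀ hwl hndvd
    · have hndvd' : ¬ l ∣ P'.W.ordMinimalDiscriminant w₀ := by
        rw [← P'.W.natCast_dvd_log_valuation_j_iff w₀ hw₀ l, ← P'.localHeight_eq_log w₀]
        exact hndvd
      obtain ⟨σ, -, hσ⟩ :=
        P'.W.exists_orderOf_galoisRepTorsion_eq_of_hasMultiplicativeReductionAt_of_not_dvd hw₀ hl
          hwl hndvd'
      exact ⟨σ, hσ⟩
  -- `SL₂(𝔽_l) ⊆ Im(Γ_{L′})`, then `SL₂(ℤ/lⁿ) ⊆ Im(Γ_{L′})` (`l ≥ 5`), then descend to `Γ_L`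
  have hSL' : P'.ImageModLContainsSL2 l :=
    P'.imageModLContainsSL2_of_not_admitsLCyclic_of_orderOf_eq l hno' hord
  have h5l : 5 ≤ l := by
    rcases hcond with ⟨hlA, -⟩ | ⟨-, -, h30⟩
    · -- `l ≥ 23040·100·d·(h + C d^ε) ≥ 2304000`
      have hh : 1 ≤ P.htFalt + C * (P.degree : ℝ) ^ ε := by
        have hdε : (1 : ℝ) ≤ (P.degree : ℝ) ^ ε := Real.one_le_rpow hd hε.le
        have hlb := hFalt_lb P
        have : C ≤ C * (P.degree : ℝ) ^ ε := le_mul_of_one_le_right hCpos.le hdε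
        rw [hCdef] at this ⊢
        nlinarith [mul_pos hC₇ h23040]
      have : (5 : ℝ) ≤ l := by nlinarith
      exact_mod_cast this
    · exact five_le_of_coprime_thirty hl h30
  have hlad' : P'.LAdicImageContainsSL2 l := P'.lAdicImageContainsSL2_of_imageModLContainsSL2 l h5l hSL'
  exact P.lAdicImageContainsSL2_of_baseChange L' l hlad' n hn

end Literature.NumberTheory.DiophantineGeometry.GenEll

end
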